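import Mathlib
import Literature.Analysis.FluidPDE.VectorCalculus
import Literature.Analysis.FluidPDE.Vorticity
import Literature.Analysis.FluidPDE.ClassicalSolution
import Literature.Analysis.FluidPDE.AxisymmetricVorticityTransport
import Summits.NavierStokesRegularity.NavierStokesRegularity.Theorems.UnthreadedDoorFluxStarvedDipoleDipoleStratumSmooth
import Summits.NavierStokesRegularity.NavierStokesRegularity.Theorems.ThreadingFluxHorizonTowerZonalForm
import HarnessLib

/-!
# Route `UnthreadedDoor`, crux `PoloidalLiouville` (stmt-NavierStokesRegularity-1222), wall W1 — crux idea
# «flux-starved-dipoles» (ns-idea-15 g12/g13, `Cruxes/PoloidalLiouville/FluxStarvedDipoleSketch.lean`):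
# `DipoleStratumOfWall` — THE DIPOLE STRATUM OF THE WALL IS EMPTY, with the sketch's `C³` data

The sketch Prop `FluxStarvedDipole.DipoleStratumOfWall` VERBATIM (with `dipolePotentialT`, `dipolePotential` unfolded): a bounded
ancient mild solution, measurable slices, smooth on `(−∞,0) × ℝ³`, whose vorticity is `∇T(t) × (x − x₀)` off `x₀` for a
turning-axis dipole potential `T(t,x) = ⟪A(t,‖x−x₀‖), x−x₀⟫/‖x−x₀‖ + R(t,‖x−x₀‖)` with `A, R` jointly `C³` on `(−∞,0) × (0,∞)`,
has CONSTANT slices.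

`dipoleStratumOfWall_smooth` (p839368) proved this for SMOOTH dipole data (the antidynamo stub `stub_potentialEvolution` wants a
smooth potential).  THIS FILE removes the extra regularity by a bootstrap, with no new analysis: under the coupling the vorticity on
`S_r(x₀)` is `A(t,r) × ê` (`cross_gradient_dipole_sphere`), so every component of `A(t,r)` is a component of `curl v(t)` at one of
the three points `x₀ + r eⱼ` (`apply_eq_cross_single`), hence `A` is automatically jointly SMOOTH on `(−∞,0) × (0,∞)` (the
vorticity of a jointly smooth field is jointly smooth); and the radial part `R` is a gauge (`∇T × (x−x₀)` does not see it,
`dipole_gradient_sphere`), so it may be replaced by `0`.  Then `dipoleStratumOfWall_smooth` applies to `(A, 0)`.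

With K1′ `dipoleNeverAncient` (this session) every typed Prop of the sketch `FluxStarvedDipoleSketch.lean` is now a kernel theorem in
its VERBATIM-unfolded form.  HONEST LABEL: the dipole (`l = 1`) stratum of W1 decided (information-grade, W1 movement 0 per critic
V28); the composition uses the landed antidynamo stubs BY NAME (`stub_vorticityOfClass`, `stub_potentialEvolution`,
`stub_constantOfIrrotational` via p839368); `PoloidalLiouville` (1222), its wall `stub_scalarLiouville` and the summit stay OPEN; NO
Navier–Stokes regularity statement is proved.  `--supports stmt-NavierStokesRegularity-1222` (helper).  [folklore]
-/

noncomputable section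

-- the summit and its single sub-problem share the name (CONVENTIONS §1)
set_option linter.dupNamespace false

open Set Filter Topology InnerProductSpace MeasureTheory
open scoped RealInnerProductSpace
open Literature.Analysis.FluidPDE
open Summit.NavierStokesRegularity.NavierStokesRegularity.Theorems.PoloidalLiouville.HorizonTower (E3 cross_fin3)

namespace Summit.NavierStokesRegularity.NavierStokesRegularity.Theorems.PoloidalLiouville.FluxStarvedDipole

/-- Componentwise recovery of a vector from its cross products with the coordinate vectors:
`a₀ = (a × e₁)₂`, `a₁ = (a × e₂)₀`, `a₂ = (a × e₀)₁`. [folklore] -/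
theorem apply_eq_cross_single (a : E3) :
    a 0 = cross a (EuclideanSpace.single 1 1) 2 ∧ a 1 = cross a (EuclideanSpace.single 2 1) 0 ∧
      a 2 = cross a (EuclideanSpace.single 0 1) 1 := by
  refine ⟨?_, ?_, ?_⟩
  · obtain ⟨-, -, h⟩ := cross_fin3 a (EuclideanSpace.single 1 1)
    rw [h]
    simp
  · obtain ⟨h, -, -⟩ := cross_fin3 a (EuclideanSpace.single 2 1)
    rw [h]
    simp
  · obtain ⟨-, h, -⟩ := cross_fin3 a (EuclideanSpace.single 0 1)
    rw [h]
    simp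

/-- Under the dipole coupling off the centre with `C³` slices, the vorticity at `x₀ + r e` (`‖e‖ = 1`, `r > 0`) is `A(r) × e`.
[folklore] -/
theorem curl_ray_eq_cross {u : E3 → E3} {x₀ : E3} {A : ℝ → E3} {R : ℝ → ℝ}
    (hA : ContDiffOn ℝ 3 A (Ioi 0)) (hR : ContDiffOn ℝ 3 R (Ioi 0))
    (hcpl : ∀ x, x ≠ x₀ → curl u x = cross (gradient (fun x => ⟪A ‖x - x₀‖, x - x₀⟫ / ‖x - x₀‖ + R ‖x - x₀‖) x) (x - x₀))
    {r : ℝ} (hr : 0 < r) {e : E3} (he : ‖e‖ = 1) :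
    curl u (x₀ + r • e) = cross (A r) e := by
  have hne : x₀ + r • e ≠ x₀ := by
    intro h
    have : r • e = 0 := by simpa using h
    rw [smul_eq_zero] at this
    rcases this with h1 | h1
    · exact hr.ne' h1
    · rw [h1, norm_zero] at he; exact zero_ne_one he
  rw [hcpl _ hne, add_sub_cancel_left]
  exact cross_gradient_dipole_sphere (fun z => rfl) hA hR hr he

/-- The radial part of the dipole potential is a GAUGE for the coupling: `∇T × (x − x₀)` is the same for `(A, R)` and `(A, R')`
(`C³` slices). [folklore] -/
theorem cross_gradient_dipole_gauge {x₀ : E3} {A : ℝ → E3} {R R' : ℝ → ℝ}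
    (hA : ContDiffOn ℝ 3 A (Ioi 0)) (hR : ContDiffOn ℝ 3 R (Ioi 0)) (hR' : ContDiffOn ℝ 3 R' (Ioi 0))
    {x : E3} (hx : x ≠ x₀) :
    cross (gradient (fun x => ⟪A ‖x - x₀‖, x - x₀⟫ / ‖x - x₀‖ + R ‖x - x₀‖) x) (x - x₀) =
      cross (gradient (fun x => ⟪A ‖x - x₀‖, x - x₀⟫ / ‖x - x₀‖ + R' ‖x - x₀‖) x) (x - x₀) := by
  have hr : 0 < ‖x - x₀‖ := norm_pos_iff.mpr (sub_ne_zero.mpr hx)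
  obtain ⟨κ, hκ⟩ := dipole_gradient_sphere (x₀ := x₀)
    (T := fun x => ⟪A ‖x - x₀‖, x - x₀⟫ / ‖x - x₀‖ + R ‖x - x₀‖) (fun z => rfl) hA hR hr
    (rfl : ‖x - x₀‖ = ‖x - x₀‖)
  obtain ⟨κ', hκ'⟩ := dipole_gradient_sphere (x₀ := x₀)
    (T := fun x => ⟪A ‖x - x₀‖, x - x₀⟫ / ‖x - x₀‖ + R' ‖x - x₀‖) (fun z => rfl) hA hR' hr
    (rfl : ‖x - x₀‖ = ‖x - x₀‖)
  rw [add_sub_cancel] at hκ hκ'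
  have cross_add_left' : ∀ a b c : E3, cross (a + b) c = cross a c + cross b c := fun a b c => by
    rw [← crossCLM_apply, ← crossCLM_apply, ← crossCLM_apply, map_add]; rfl
  have cross_self' : ∀ a : E3, cross a a = 0 := fun a => by
    rw [← crossCLM_apply]
    have h := cross_fin3 a a
    ext i
    fin_cases i
    · simp only [crossCLM_apply, Fin.zero_eta, Fin.isValue, PiLp.zero_apply]; rw [h.1]; ring
    · simp only [crossCLM_apply, Fin.mk_one, Fin.isValue, PiLp.zero_apply]; rw [h.2.1]; ring
    · simp only [crossCLM_apply, Fin.reduceFinMk, Fin.isValue, PiLp.zero_apply]; rw [h.2.2]; ring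
  rw [hκ, hκ', cross_add_left', cross_add_left', cross_smul_left κ, cross_smul_left κ', cross_self', smul_zero, smul_zero]

/-- **THE DIPOLE STRATUM OF THE WALL IS EMPTY** — the sketch Prop `FluxStarvedDipole.DipoleStratumOfWall` VERBATIM (with
`dipolePotentialT`, `dipolePotential` unfolded; `C³` dipole data as in the sketch): a bounded ancient mild solution, measurable
slices, smooth on `(−∞,0) × ℝ³`, whose vorticity is `∇T(t) × (x − x₀)` off `x₀` for a turning-axis dipole potential with `A, R`
jointly `C³` on `(−∞,0) × (0,∞)`, has CONSTANT slices.  Bootstrap (`A` is automatically smooth, `R` is a gauge) +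
`dipoleStratumOfWall_smooth`. [folklore] -/
theorem dipoleStratumOfWall :
    ∀ (v : ℝ → E3 → E3) (x₀ : E3) (A : ℝ → ℝ → E3) (R : ℝ → ℝ → ℝ),
      Literature.Analysis.FluidPDE.IsBoundedAncientMildSolution 1 v →
      (∀ t < 0, AEStronglyMeasurable (v t) volume) →
      ContDiffOn ℝ (⊤ : ℕ∞) (Function.uncurry v) (Set.Iio 0 ×ˢ Set.univ) →
      ContDiffOn ℝ 3 (Function.uncurry A) (Set.Iio 0 ×ˢ Set.Ioi 0) →
      ContDiffOn ℝ 3 (Function.uncurry R) (Set.Iio 0 ×ˢ Set.Ioi 0) →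
      (∀ t < 0, ∀ x, x ≠ x₀ →
        curl (v t) x = cross (gradient (fun x => ⟪A t ‖x - x₀‖, x - x₀⟫ / ‖x - x₀‖ + R t ‖x - x₀‖) x) (x - x₀)) →
      ∀ t < 0, ∃ b : E3, ∀ x, v t x = b := by
  intro v x₀ A R hB hmeas hsm hA hR hcpl
  have hAt : ∀ t < 0, ContDiffOn ℝ 3 (A t) (Ioi 0) := fun t ht => slice_contDiffOn_right hA ht
  have hRt : ∀ t < 0, ContDiffOn ℝ 3 (R t) (Ioi 0) := fun t ht => slice_contDiffOn_right hR ht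
  -- joint smoothness of the vorticity, hence of its values along the three coordinate rays
  have hsm' : IsSmoothSpaceTimeOn (Iio 0) v := hsm
  have hω : ContDiffOn ℝ (⊤ : ℕ∞) (Function.uncurry fun t x => curl (v t) x) (Set.Iio 0 ×ˢ Set.univ) :=
    hsm'.isSmoothSpaceTimeOn_vorticity (uniqueDiffOn_Iio 0)
  have hray : ∀ (e : E3) (i : Fin 3),
      ContDiffOn ℝ (⊤ : ℕ∞) (fun p : ℝ × ℝ => curl (v p.1) (x₀ + p.2 • e) i) (Set.Iio 0 ×ˢ Set.Ioi 0) := by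
    intro e i
    have hΦ : ContDiffOn ℝ (⊤ : ℕ∞) (fun p : ℝ × ℝ => (p.1, x₀ + p.2 • e)) (Set.Iio 0 ×ˢ Set.Ioi 0) := by
      fun_prop
    have hmaps : Set.MapsTo (fun p : ℝ × ℝ => (p.1, x₀ + p.2 • e)) (Set.Iio 0 ×ˢ Set.Ioi 0)
        (Set.Iio 0 ×ˢ (Set.univ : Set E3)) := fun p hp => ⟨hp.1, Set.mem_univ _⟩
    have h1 : ContDiffOn ℝ (⊤ : ℕ∞) (fun p : ℝ × ℝ => curl (v p.1) (x₀ + p.2 • e)) (Set.Iio 0 ×ˢ Set.Ioi 0) :=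
      hω.comp hΦ hmaps
    exact contDiffOn_euclidean.mp h1 i
  -- `A` is automatically smooth
  have hAs : ContDiffOn ℝ (⊤ : ℕ∞) (Function.uncurry A) (Set.Iio 0 ×ˢ Set.Ioi 0) := by
    have hnorm : ∀ j : Fin 3, ‖(EuclideanSpace.single j (1 : ℝ) : E3)‖ = 1 := fun j => by
      simp
    refine contDiffOn_euclidean.mpr fun i => ?_
    have key : ∀ (j k : Fin 3), (∀ a : E3, a i = cross a (EuclideanSpace.single j 1) k) →
        ContDiffOn ℝ (⊤ : ℕ∞) (fun p : ℝ × ℝ => Function.uncurry A p i) (Set.Iio 0 ×ˢ Set.Ioi 0) := by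
      intro j k hjk
      refine (hray (EuclideanSpace.single j 1) k).congr ?_
      rintro ⟨t, r⟩ ⟨ht, hr⟩
      simp only [Function.uncurry_apply_pair]
      rw [hjk (A t r), ← curl_ray_eq_cross (hAt t ht) (hRt t ht) (hcpl t ht) hr (hnorm j)]
    fin_cases i
    · exact key 1 2 fun a => (apply_eq_cross_single a).1
    · exact key 2 0 fun a => (apply_eq_cross_single a).2.1
    · exact key 0 1 fun a => (apply_eq_cross_single a).2.2
  -- the radial part is a gauge: replace it by `0`
  set R₀ : ℝ → ℝ → ℝ := fun _ _ => 0 with hR₀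
  have hR₀s : ContDiffOn ℝ (⊤ : ℕ∞) (Function.uncurry R₀) (Set.Iio 0 ×ˢ Set.Ioi 0) := contDiffOn_const
  have hcpl₀ : ∀ t < 0, ∀ x, x ≠ x₀ →
      curl (v t) x = cross (gradient (fun x => ⟪A t ‖x - x₀‖, x - x₀⟫ / ‖x - x₀‖ + R₀ t ‖x - x₀‖) x) (x - x₀) := by
    intro t ht x hx
    rw [hcpl t ht x hx]
    exact cross_gradient_dipole_gauge (hAt t ht) (hRt t ht) contDiffOn_const hx
  exact dipoleStratumOfWall_smooth v x₀ A R₀ hB hmeas hsm hAs hR₀s hcpl₀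

end Summit.NavierStokesRegularity.NavierStokesRegularity.Theorems.PoloidalLiouville.FluxStarvedDipole

end
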